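import Summits.AtomisticToContinuum.HydrodynamicLimit.Theorems.OneFlightGossipEngineCollisionActivityTailsContact
import HarnessLib

/-!
# The co-moving pair virial at one collision (helper for stub `stub_activityDomination`, line SketchK1)

Crux `Summit.AtomisticToContinuum.HydrodynamicLimit.Theses.OneFlightGossipEngine.CollisionActivityTails`
(stmt-AtomisticToContinuum-13734), line `SketchK1`, stub `stub_activityDomination : ActivityDomination`.

For a hard-sphere trajectory `γ` of `n` spheres of diameter `ε ≤ 1/8` on `𝕋³`, a tagged sphere `i` and a field
`ζ : ℝ³ → ℝ³` that is the identity on the core `‖y‖ ≤ ε`, vanishes beyond `2ε`, has norm `≤ 2ε` and satisfies the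
contact-segment bound `⟪ζ(a + t n) − ζ(a), n⟫ ≥ −2Dt` (the radial cutoff of `…CollisionActivityTailsCutoff`), the JUMP at
a collision time `t` of the co-moving pair virial `pairVirial ζ i = Σ_j ⟪ζ(sep(x_j, x_i)), v_j − v_i⟫` controls the
impulse received by `i`:

`2ε · ownImpulse ≤ collisionJump (pairVirial ζ i) γ t + ε · max 125 D · crowdImpulse` (`collision_step`),

where `ownImpulse = Σ_{(p,q) contact pairs, p = i} |Δv_p|` (`= |Δv_i|` if `i` collides at `t`, else `0`) and
`crowdImpulse = Σ_{(p,q) contact pairs} 𝟙{x_p, x_q within 3ε of x_i ∧ ≥ 3 centres within 3ε of x_i} |Δv_p|`.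
Cases: (own, isolated) the jump is EXACTLY `2ε|Δv_i|` — `Δv_i = c (x_i − x_m)`, `c > 0` (repulsive contact), and
`ζ(x_m − x_i) = x_m − x_i`; (own, crowded) the third spheres within `2ε` (at most `125`, hard-core packing
`card_near_le`) perturb it by `≤ 2ε · 125 |Δv_i|`, paid by the crowd term; (other pair `(a,b)`, one partner within `2ε`
of `x_i`) the jump `⟪ζ(sep_a) − ζ(sep_b), Δv_a⟫ = cε ⟪ζ(sep_b + ε n̂) − ζ(sep_b), n̂⟫ ≥ −2Dε|Δv_a|` (minimal images
add up away from the cut locus, `reprSym_sub_reprSym`), again paid by the crowd term; otherwise the jump vanishes.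
The registered helper statement is `CollisionStepToolkit`.
-/

noncomputable section

open Set Filter Topology Function
open scoped InnerProductSpace

namespace Summit.AtomisticToContinuum.HydrodynamicLimit.Theorems.CollisionActivityTailsCollisionStep

open Literature.Analysis.FluidPDE Literature.Analysis.FunctionSpaces
open Literature.MathematicalPhysics.KineticTheory (T3 V3)
open Summit.AtomisticToContinuum.HydrodynamicLimit.Theorems.CollisionActivityTailsContact

variable {n : ℕ}

/-! ## The per-collision inequality -/

section Step

variable {ε D : ℝ} {γ : ℝ → Config n (Fin 3) T3} {ζ : V3 → V3}

local notation "G3" => Torus.geometry (Fin 3)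

/-- **OWN CASE.** If the tagged sphere `i` collides at `t` with partner `m`:
`2ε |Δv_i| ≤ jump + ε · 125 · crowdImpulse` (exact `2ε|Δv_i|` when isolated; the `≤ 125` third spheres within `2ε`
perturb the jump by at most `2ε · 125 · |Δv_i|`, and then the collision is crowded with `crowdImpulse = 2|Δv_i|`). -/
theorem step_own (hε : 0 < ε) (hε8 : ε ≤ 1 / 8) (hγ : IsHardSphereTrajectory G3 ε n γ)
    (hcore : ∀ y, ‖y‖ ≤ ε → ζ y = y) (hvan : ∀ y, 2 * ε ≤ ‖y‖ → ζ y = 0) (hnb : ∀ y, ‖ζ y‖ ≤ 2 * ε)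
    {i m : Fin n} {t : ℝ} (him : (i, m) ∈ contactPairs G3 ε (γ t)) :
    2 * ε * ownImpulse ε γ i t ≤ collisionJump (pairVirial ζ i) γ t + ε * 125 * crowdImpulse ε γ i t := by
  classical
  obtain ⟨hne, hnorm, hΔm, hothers, c, hc, hΔi, himp⟩ := contact_kinematics hγ him
  set Δ : V3 := (γ t i).2 - (leftLim γ t i).2 with hΔdef
  set nv := (Torus.geometry (Fin 3)).sepVec (γ t i).1 (γ t m).1 with hnv
  -- own impulse = |Δv_i|
  have hown : ownImpulse ε γ i t = impulse γ t i := by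
    unfold ownImpulse
    rw [sum_contactPairs_pair hε8 hγ him]
    simp [hne.symm]
  -- the separation seen from `i`: `reprSym (x_m − x_i) = −nv`, and `ζ(−nv) = −nv`
  have hsep_m : Torus.reprSym ((γ t m).1 - (γ t i).1) = -nv := by
    have h := (regular hε8).sepVec_comm (γ t i).1 (γ t m).1 (le_of_eq hnorm)
    rw [hnv]
    exact h
  have hmi : tdist (γ t m).1 (γ t i).1 = ε := by rw [tdist_comm]; exact hnorm
  have hζm : ζ (Torus.reprSym ((γ t m).1 - (γ t i).1)) = -nv := by
    rw [hsep_m]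
    exact hcore _ (by rw [norm_neg, hnorm])
  -- third spheres near `i`
  set S3 := Finset.univ.filter fun j : Fin n => j ≠ i ∧ j ≠ m ∧ tdist (γ t j).1 (γ t i).1 < 2 * ε with hS3
  -- termwise lower bound for the jump
  have hterm : ∀ j, (if j = m then 2 * ε * impulse γ t i else 0) +
      (if j ∈ S3 then -(2 * ε * impulse γ t i) else 0) ≤
      ⟪ζ (Torus.reprSym ((γ t j).1 - (γ t i).1)),
        ((γ t j).2 - (leftLim γ t j).2) - ((γ t i).2 - (leftLim γ t i).2)⟫_ℝ := by
    intro j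
    by_cases hjm : j = m
    · subst hjm
      have hjS : j ∉ S3 := by simp [hS3]
      rw [if_pos rfl, if_neg hjS, add_zero, hΔm, hζm, ← hΔdef]
      have : -Δ - Δ = -((2 : ℝ) • Δ) := by rw [two_smul]; abel
      rw [this, inner_neg_right, inner_neg_left, neg_neg, inner_smul_right, hΔi, inner_smul_right,
        real_inner_self_eq_norm_sq, hnorm, himp]
      nlinarith [hc, hε]
    by_cases hji : j = i
    · subst hji
      have hjS : j ∉ S3 := by simp [hS3]
      simp only [if_neg hjm, if_neg hjS, zero_add, sub_self, inner_zero_right, le_refl]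
    -- a third sphere: its own jump vanishes
    rw [if_neg hjm, hothers j hji hjm, zero_sub, inner_neg_right, zero_add]
    by_cases hjS : j ∈ S3
    · rw [if_pos hjS, neg_le_neg_iff, ← hΔdef]
      calc ⟪ζ (Torus.reprSym ((γ t j).1 - (γ t i).1)), Δ⟫_ℝ
          ≤ ‖ζ (Torus.reprSym ((γ t j).1 - (γ t i).1))‖ * ‖Δ‖ := real_inner_le_norm _ _
        _ ≤ 2 * ε * impulse γ t i := mul_le_mul_of_nonneg_right (hnb _) (norm_nonneg _)
    · rw [if_neg hjS]
      have hfar : 2 * ε ≤ tdist (γ t j).1 (γ t i).1 := by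
        by_contra hlt
        exact hjS (by simp [hS3, hji, hjm, not_le.1 hlt])
      rw [hvan _ (by rw [← tdist_eq]; exact hfar), inner_zero_left, neg_zero]
  have hsum := Finset.sum_le_sum fun j (_ : j ∈ Finset.univ) => hterm j
  rw [← collisionJump_pairVirial hε8 hγ ζ i t, Finset.sum_add_distrib] at hsum
  simp only [Finset.sum_ite_eq', Finset.mem_univ, if_true, Finset.sum_ite_mem, Finset.univ_inter,
    Finset.sum_neg_distrib, Finset.sum_const, nsmul_eq_mul] at hsum
  -- `hsum : 2ε|Δ| - #S3 · 2ε|Δ| ≤ jump`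
  rw [hown]
  by_cases h0 : S3.card = 0
  · rw [h0, Nat.cast_zero, zero_mul, neg_zero, add_zero] at hsum
    have hcrowd : 0 ≤ crowdImpulse ε γ i t := by
      unfold crowdImpulse
      exact Finset.sum_nonneg fun p _ => by split_ifs <;> [exact norm_nonneg _; exact le_rfl]
    nlinarith [hsum, hcrowd, hε.le]
  · -- crowded: a third sphere `j₀` within `2ε`
    obtain ⟨j₀, hj₀⟩ := Finset.card_pos.1 (Nat.pos_of_ne_zero h0)
    have hj₀' := (Finset.mem_filter.1 hj₀).2
    have hii : tdist (γ t i).1 (γ t i).1 ≤ 3 * ε := by rw [tdist_self]; linarith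
    have hmi' : tdist (γ t m).1 (γ t i).1 ≤ 3 * ε := by rw [hmi]; linarith
    have hcrowded : 3 ≤ nearCount (γ t) i (3 * ε) :=
      three_le_nearCount (a := i) (b := m) (c := j₀) hne (fun h => hj₀'.1 h.symm) (fun h => hj₀'.2.1 h.symm)
        hii hmi' (by linarith [hj₀'.2.2])
    have hcrowd : crowdImpulse ε γ i t = 2 * impulse γ t i := by
      unfold crowdImpulse
      rw [sum_contactPairs_pair hε8 hγ him]
      rw [if_pos ⟨hii, hmi', hcrowded⟩, if_pos ⟨hmi', hii, hcrowded⟩]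
      have : impulse γ t m = impulse γ t i := by rw [impulse, impulse, hΔm, norm_neg]
      rw [this]
      ring
    -- `#S3 ≤ 125` (hard-core packing)
    have hS3le : (S3.card : ℝ) ≤ 125 := by
      have hsub : S3 ⊆ Finset.univ.filter fun j : Fin n => tdist (γ t j).1 (γ t i).1 ≤ 2 * ε := by
        intro j hj
        rw [Finset.mem_filter] at hj ⊢
        exact ⟨hj.1, hj.2.2.2.le⟩
      have hdom : γ t ∈ hardSphereDomain G3 n ε := hγ.mem t
      have h125 : (Finset.univ.filter fun j : Fin n => tdist (γ t j).1 (γ t i).1 ≤ 2 * ε).card ≤ 125 :=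
        card_near_le hε hdom i
      exact_mod_cast (Finset.card_le_card hsub).trans h125
    rw [hcrowd]
    have himp0 : 0 ≤ impulse γ t i := norm_nonneg _
    nlinarith [hsum, hS3le, himp0, hε.le, mul_nonneg hε.le himp0,
      mul_nonneg (mul_nonneg hε.le himp0) (by linarith : (0 : ℝ) ≤ 125 - S3.card)]

/-- **OTHER CASE.** If the pair `(a, b)` collides at `t` and `i ∉ {a, b}`: `0 ≤ jump + ε · D · crowdImpulse`
(the jump `⟪ζ(sep_a) − ζ(sep_b), Δv_a⟫` vanishes unless a partner is within `2ε` of `x_i`; then both are within `3ε`,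
the collision is crowded with `crowdImpulse = 2|Δv_a|`, and the segment bound gives `jump ≥ −2Dε|Δv_a|`). -/
theorem step_other (hε : 0 < ε) (hε8 : ε ≤ 1 / 8) (hγ : IsHardSphereTrajectory G3 ε n γ)
    (hvan : ∀ y, 2 * ε ≤ ‖y‖ → ζ y = 0) (hD : 0 ≤ D)
    (hseg : ∀ a m : V3, ‖m‖ = 1 → ∀ s : ℝ, 0 ≤ s → -(2 * D) * s ≤ ⟪ζ (a + s • m) - ζ a, m⟫_ℝ)
    {i a b : Fin n} {t : ℝ} (hab : (a, b) ∈ contactPairs G3 ε (γ t)) (hia : i ≠ a) (hib : i ≠ b) :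
    2 * ε * ownImpulse ε γ i t ≤ collisionJump (pairVirial ζ i) γ t + ε * D * crowdImpulse ε γ i t := by
  classical
  -- reduce to the orientation in which `a` is the partner closer to `x_i` (the jump is orientation-free)
  wlog hnear : tdist (γ t a).1 (γ t i).1 ≤ tdist (γ t b).1 (γ t i).1 generalizing a b
  · exact this ((swap_mem_contactPairs_iff (regular hε8) (p := (b, a))).1 hab) hib hia (le_of_not_ge hnear)
  obtain ⟨hne, hnorm, hΔb, hothers, c, hc, hΔa, himp⟩ := contact_kinematics hγ hab
  have hown : ownImpulse ε γ i t = 0 := by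
    unfold ownImpulse
    rw [sum_contactPairs_pair hε8 hγ hab]
    simp [hia.symm, hib.symm]
  have hcrowd0 : 0 ≤ crowdImpulse ε γ i t := by
    unfold crowdImpulse
    exact Finset.sum_nonneg fun p _ => by split_ifs <;> [exact norm_nonneg _; exact le_rfl]
  -- the jump
  have hjump : collisionJump (pairVirial ζ i) γ t =
      ⟪ζ (Torus.reprSym ((γ t a).1 - (γ t i).1)) - ζ (Torus.reprSym ((γ t b).1 - (γ t i).1)),
        (γ t a).2 - (leftLim γ t a).2⟫_ℝ := by
    rw [collisionJump_pairVirial hε8 hγ ζ i t, hothers i hia hib]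
    simp only [sub_zero]
    rw [Fintype.sum_eq_add a b hne (fun j hj => by rw [hothers j hj.1 hj.2, inner_zero_right]), hΔb,
      inner_neg_right, inner_sub_left]
    ring
  rw [hown, mul_zero]
  by_cases hfar : 2 * ε ≤ tdist (γ t a).1 (γ t i).1
  · -- both partners far: the jump vanishes
    rw [hjump, hvan _ (by rw [← tdist_eq]; exact hfar), hvan _ (by rw [← tdist_eq]; exact hfar.trans hnear),
      sub_self, inner_zero_left, zero_add]
    exact mul_nonneg (mul_nonneg hε.le hD) hcrowd0
  · rw [not_le] at hfar
    -- `a` within `2ε`, hence `b` within `3ε`; crowded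
    have hbi : tdist (γ t b).1 (γ t i).1 < 3 * ε := by
      calc tdist (γ t b).1 (γ t i).1 ≤ tdist (γ t b).1 (γ t a).1 + tdist (γ t a).1 (γ t i).1 := tdist_triangle _ _ _
        _ < ε + 2 * ε := by
            refine add_lt_add_of_le_of_lt (le_of_eq ?_) hfar
            rw [tdist_comm]; exact hnorm
        _ = 3 * ε := by ring
    have hcrowded : 3 ≤ nearCount (γ t) i (3 * ε) :=
      three_le_nearCount hia hib hne (by rw [tdist_self]; linarith) (by linarith) hbi.le
    have hcrowd : crowdImpulse ε γ i t = 2 * impulse γ t a := by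
      unfold crowdImpulse
      rw [sum_contactPairs_pair hε8 hγ hab, if_pos ⟨by linarith, hbi.le, hcrowded⟩,
        if_pos ⟨hbi.le, by linarith, hcrowded⟩]
      have : impulse γ t b = impulse γ t a := by rw [impulse, impulse, hΔb, norm_neg]
      rw [this]
      ring
    -- minimal images add up: `sep_a = sep_b + nv`
    set nv := (Torus.geometry (Fin 3)).sepVec (γ t a).1 (γ t b).1 with hnv
    have hadd : Torus.reprSym ((γ t a).1 - (γ t i).1) = Torus.reprSym ((γ t b).1 - (γ t i).1) + nv := by
      have h := reprSym_sub_reprSym (u := (γ t a).1 - (γ t i).1) (v := (γ t b).1 - (γ t i).1) (by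
        have e : (γ t a).1 - (γ t i).1 - ((γ t b).1 - (γ t i).1) = (γ t a).1 - (γ t b).1 := by abel
        rw [e, ← tdist_eq, ← tdist_eq, show ‖Torus.reprSym ((γ t a).1 - (γ t b).1)‖ = ε from hnorm]
        linarith)
      have e : (γ t a).1 - (γ t i).1 - ((γ t b).1 - (γ t i).1) = (γ t a).1 - (γ t b).1 := by abel
      rw [e] at h
      rw [hnv, Torus.geometry_sepVec, ← h]
      abel
    -- the segment bound along the contact direction
    have hu1 : ‖ε⁻¹ • nv‖ = 1 := by
      rw [norm_smul, norm_inv, Real.norm_eq_abs, abs_of_pos hε, hnorm, inv_mul_cancel₀ hε.ne']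
    have hseg' := hseg (Torus.reprSym ((γ t b).1 - (γ t i).1)) (ε⁻¹ • nv) hu1 ε hε.le
    rw [smul_smul, mul_inv_cancel₀ hε.ne', one_smul, inner_smul_right] at hseg'
    set X : ℝ := ⟪ζ (Torus.reprSym ((γ t b).1 - (γ t i).1) + nv) - ζ (Torus.reprSym ((γ t b).1 - (γ t i).1)), nv⟫_ℝ
      with hX
    have hkey : -(2 * D) * ε * ε ≤ X := by
      have h1 := mul_le_mul_of_nonneg_left hseg' hε.le
      have h2 : ε * (ε⁻¹ * X) = X := by rw [← mul_assoc, mul_inv_cancel₀ hε.ne', one_mul]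
      rw [h2] at h1
      nlinarith [h1]
    rw [hjump, hadd, hΔa, inner_smul_right, hcrowd, himp]
    nlinarith [mul_le_mul_of_nonneg_left hkey hc.le, hc, hε, hD]

/-- **THE COLLISION STEP.** At every collision time of a hard-sphere trajectory on `𝕋³` (diameter `0 < ε ≤ 1/8`), for a
field that is the identity on the core, vanishes beyond `2ε`, has norm `≤ 2ε` and obeys the segment bound with
constant `D ≥ 0`: `2ε · ownImpulse ≤ collisionJump (pairVirial ζ i) γ t + ε · max 125 D · crowdImpulse`. -/
theorem collision_step (hε : 0 < ε) (hε8 : ε ≤ 1 / 8) (hγ : IsHardSphereTrajectory G3 ε n γ)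
    (hcore : ∀ y, ‖y‖ ≤ ε → ζ y = y) (hvan : ∀ y, 2 * ε ≤ ‖y‖ → ζ y = 0) (hnb : ∀ y, ‖ζ y‖ ≤ 2 * ε)
    (hD : 0 ≤ D) (hseg : ∀ a m : V3, ‖m‖ = 1 → ∀ s : ℝ, 0 ≤ s → -(2 * D) * s ≤ ⟪ζ (a + s • m) - ζ a, m⟫_ℝ)
    (i : Fin n) {t : ℝ} (ht : t ∈ collisionTimes G3 ε γ) :
    2 * ε * ownImpulse ε γ i t ≤
      collisionJump (pairVirial ζ i) γ t + ε * max 125 D * crowdImpulse ε γ i t := by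
  obtain ⟨⟨p, q⟩, hpq⟩ := mem_collisionTimes_iff_contactPairs_nonempty.1 ht
  have hcrowd0 : 0 ≤ crowdImpulse ε γ i t := by
    unfold crowdImpulse
    exact Finset.sum_nonneg fun p _ => by split_ifs <;> [exact norm_nonneg _; exact le_rfl]
  have hmono : ∀ K : ℝ, K ≤ max 125 D →
      collisionJump (pairVirial ζ i) γ t + ε * K * crowdImpulse ε γ i t ≤
        collisionJump (pairVirial ζ i) γ t + ε * max 125 D * crowdImpulse ε γ i t := fun K hK => by
    have := mul_le_mul_of_nonneg_right (mul_le_mul_of_nonneg_left hK hε.le) hcrowd0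
    linarith
  by_cases hi : i = p ∨ i = q
  · obtain ⟨m, him⟩ : ∃ m, (i, m) ∈ contactPairs G3 ε (γ t) := by
      rcases hi with rfl | rfl
      · exact ⟨q, hpq⟩
      · exact ⟨p, (swap_mem_contactPairs_iff (regular hε8) (p := (i, p))).1 hpq⟩
    exact (step_own hε hε8 hγ hcore hvan hnb him).trans (hmono 125 (le_max_left _ _))
  · rw [not_or] at hi
    exact (step_other hε hε8 hγ hvan hD hseg hpq hi.1 hi.2).trans (hmono D (le_max_right _ _))

end Step

/-! ## The registered helper statement -/

/-- **Collision-step toolkit** (helper statement of stub `stub_activityDomination`, line SketchK1): for every number of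
spheres `n`, diameter `0 < ε ≤ 1/8`, hard-sphere trajectory `γ` on `𝕋³`, field `ζ` as above with constant `D ≥ 0`,
tagged sphere `i` and collision time `t`:
`2ε · ownImpulse ε γ i t ≤ collisionJump (pairVirial ζ i) γ t + ε · max 125 D · crowdImpulse ε γ i t`. -/
def CollisionStepToolkit : Prop :=
  ∀ (n : ℕ) (ε D : ℝ), 0 < ε → ε ≤ 1 / 8 → 0 ≤ D → ∀ (γ : ℝ → Config n (Fin 3) T3),
    IsHardSphereTrajectory (Torus.geometry (Fin 3)) ε n γ → ∀ (ζ : V3 → V3),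
    (∀ y, ‖y‖ ≤ ε → ζ y = y) → (∀ y, 2 * ε ≤ ‖y‖ → ζ y = 0) → (∀ y, ‖ζ y‖ ≤ 2 * ε) →
    (∀ a m : V3, ‖m‖ = 1 → ∀ s : ℝ, 0 ≤ s → -(2 * D) * s ≤ ⟪ζ (a + s • m) - ζ a, m⟫_ℝ) →
    ∀ (i : Fin n) (t : ℝ), t ∈ collisionTimes (Torus.geometry (Fin 3)) ε γ →
      2 * ε * ownImpulse ε γ i t ≤
        collisionJump (pairVirial ζ i) γ t + ε * max 125 D * crowdImpulse ε γ i t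

/-- The collision-step toolkit holds (registered helper `stub_collisionStepToolkit` of line SketchK1). -/
theorem stub_collisionStepToolkit : CollisionStepToolkit :=
  fun _n _ε _D hε hε8 hD _γ hγ _ζ hcore hvan hnb hseg i _t ht =>
    collision_step hε hε8 hγ hcore hvan hnb hD hseg i ht

end Summit.AtomisticToContinuum.HydrodynamicLimit.Theorems.CollisionActivityTailsCollisionStep

end
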